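import Literature.MathematicalPhysics.QuantumLattice.AnisotropicKLSIntegralBound
import Literature.MathematicalPhysics.QuantumLattice.AnisotropicXYUnconditionalLongRangeOrder
import HarnessLib

/-!
# The anisotropic Kennedy–Lieb–Shastry integral in every dimension: `I_K ≤ I_{(1,1)} < 1/√2` for all
# couplings `K ≥ 0` with `2 max K ≤ Σᵢ Kᵢ`; long-range order of `H_K` on `ℤ^d`, `d ≥ 3`

Topic `MathematicalPhysics/QuantumLattice`; extends the layered (`K = (1,1,r)`, `d = 3`) reduction
of `AnisotropicKLSIntegralBound.lean` to every dimension and every admissible coupling vector, and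
draws the long-range-order consequences through `AnisotropicKLSIntegral.lean`
(`xyAniso_longRangeOrder_{ground,thermal}_of_integral`, `d ≥ 3`). No definition, no named fact.

Kennedy–Lieb–Shastry's proof of `I(ν) ≤ I(2)` ([KLS1988PRL] p. 2584, after eq. (8)) writes the
mean `ν⁻¹Σᵢ cos pᵢ` as the average of the pair averages `½(cos pᵢ + cos pⱼ)` and applies Jensen to
the convex one-variable function. For direction-dependent couplings the integrand is
`F_K = H(Σᵢ wᵢ cos pᵢ)`, `w = K/κ_K`, `H(y) = y₊(2/(1-y))^{1/2}` convex below `1`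
(`anisoKlsIntegrand_eq_klsH`, `convexOn_klsH` of `AnisotropicKLSPairDomination.lean`), and the same
argument needs `w` to be a convex combination of pair midpoints `½(eᵢ + eⱼ)`, i.e. a symmetric
matrix `M ≥ 0` with zero diagonal and row sums `w`. Such a matrix exists exactly when
`2 max w ≤ Σ w` (a nonnegative vector is the degree sequence of a weighted loopless graph iff no
entry exceeds the sum of the others); we give the explicit realisation
`M_{jk} = c wⱼ w_k` (`j, k ≠ i₀`), `M_{i₀j} = wⱼ(1 - c(T - wⱼ))`, `i₀` an index of the maximum,
`T = Σ_{j≠i₀} wⱼ`, `c = (T - w_{i₀})/Σ_{j≠i₀} wⱼ(T - wⱼ)` (`exists_symm_pairWeights`). Then: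

* `anisoKlsIntegrand_le_sum_pairs` — Jensen: `F_K(p) ≤ Σ_{i,j} M_{ij} F_{(1,1)}(pᵢ, pⱼ)` whenever
  all `cos pᵢ < 1`;
* `setLIntegral_box_pair` — integrating out the other coordinates:
  `∫_{[-π,π]^{n+2}} f(pᵢ, pⱼ) dp = (2π)ⁿ ∫_{[-π,π]²} f(q₀, q₁) dq` for `i ≠ j` and symmetric measurable
  `f ≥ 0` (iterating the tree's one-coordinate deletion `setLIntegral_box_comp_succAbove`);
* `lintegral_anisoKlsIntegrand_le_two_pow` — `∫_{[-π,π]^{n+2}} F_K ≤ (2π)ⁿ ∫_{[-π,π]²} F_{(1,1)}`,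
  hence **`I_K ≤ I_{(1,1)}`** (`anisoKlsIntegral_le_two`) and, with `anisoKlsIntegral_two_lt`
  (`I_{(1,1)} ≤ √2/4 + (3823/5040)√2/π < √2/2`), **`I_K < 1/√2`** (`anisoKlsIntegral_lt_of_two_mul_le`)
  for every `d ≥ 2` and every `K ≥ 0` with `κ_K > 0`, `2 max K ≤ κ_K`;
* **long-range order, unconditional, in every dimension `d ≥ 3`**: for every `K > 0` with
  `2 max K ≤ Σᵢ Kᵢ` and every spin `S = n/2 ≥ ½`, the ground states of
  `H_K = -Σ_xΣᵢ Kᵢ(S¹_xS¹_{x+eᵢ} + S²_xS²_{x+eᵢ})` on the even tori `(ℤ/2kℤ)^d` have long-range order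
  (`xyAniso_longRangeOrder_ground_of_two_mul_le`) and so do the Gibbs states for `β ≥ β₀`
  (`xyAniso_longRangeOrder_thermal_of_two_mul_le`) — Kennedy–Lieb–Shastry's theorem ("all spins
  and all dimensions greater than one", ground state; [KLS1988JSP] p. 1020 for `T > 0` in `d ≥ 3`)
  for direction-dependent nearest-neighbour couplings, XY / hard-core-boson version. The isotropic
  `K ≡ 1` (`2 ≤ d`) and the layered `(1, …, 1, r)`, `0 < r ≤ d - 1`, are included;
* **an explicit floor on the ground-state order parameter in every dimension `d ≥ 3`**:
  `liminf_k |Λ_k|⁻² Σ_{x,y∈Λ_k}⟨S¹_xS¹_y + S²_xS²_y⟩ ≥ n²/4 - n(1/8 + 3823/(10080π))` for all such `K`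
  (`xyAniso_groundOrderParameter_ge_of_two_mul_le`, from `xyAniso_groundOrderParameter_ge` of
  `AnisotropicXYUnconditionalLongRangeOrder.lean` and `I_K ≤ I_{(1,1)} ≤ √2/4 + (3823/5040)√2/π`);
  for `S = ½`: `≥ 1/8 - 3823/(10080π) = 0.0042…` uniformly in `d` and `K`.

## References

* [KLS1988PRL] T. Kennedy, E. H. Lieb, B. S. Shastry, *The XY model has long-range order for all
  spins and all dimensions greater than one*, Phys. Rev. Lett. 61 (1988) 2582–2584, Theorem, eq. (8)
  and p. 2584 ("`I(ν) ≤ I(2)` … by the same analysis `I(ν) ≤ I(μ)` whenever `ν > μ`").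
* [KLS1988JSP] T. Kennedy, E. H. Lieb, B. S. Shastry, J. Stat. Phys. 53 (1988) 1019–1030, §3,
  p. 1020.
* [DLS1978] F. J. Dyson, E. H. Lieb, B. Simon, J. Stat. Phys. 18 (1978) 335–383, Thms. 5.1–5.2.
-/

noncomputable section

open MeasureTheory Set Filter Topology
open scoped ENNReal
open Literature.MathematicalPhysics.QuantumLattice Literature.Probability.LatticeModels
  Literature.MathematicalPhysics.QuantumLattice.XYOrderProofs

namespace Literature.MathematicalPhysics.QuantumLattice

/-! ### Weighted loopless graphs with prescribed degrees: the pair-weight matrix -/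

section PairWeights

/-- **A nonnegative vector with no entry above the sum of the others is the degree sequence of a
weighted loopless graph**: if `w ≥ 0`, `Σ w = 1` and `2wᵢ ≤ 1` for all `i`, there is a symmetric
matrix `M ≥ 0` with zero diagonal and row sums `Σⱼ M_{ij} = wᵢ` — equivalently `w` is the convex
combination `Σ_{i≠j} M_{ij} · ½(eᵢ + eⱼ)` of pair midpoints. Explicitly, with `i₀` an index of the
maximum, `T = Σ_{j≠i₀} wⱼ` and `c = (T - w_{i₀})/Σ_{j≠i₀} wⱼ(T - wⱼ)`:
`M_{jk} = c wⱼ w_k` for `j ≠ k` both `≠ i₀`, `M_{i₀j} = M_{ji₀} = wⱼ(1 - c(T - wⱼ))`. (This is the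
combinatorial content of Kennedy–Lieb–Shastry's "`Y(p) = (ν² - ν)⁻¹ Σ_{i≠j} Y_{ij}(p)`" for unequal
weights.) [cite: KLS1988PRL, after eq. (8)] -/
theorem exists_symm_pairWeights {d : ℕ} (w : Fin d → ℝ) (hw0 : ∀ i, 0 ≤ w i)
    (hw1 : ∑ i, w i = 1) (hw2 : ∀ i, 2 * w i ≤ 1) :
    ∃ M : Fin d → Fin d → ℝ, (∀ i j, 0 ≤ M i j) ∧ (∀ i, M i i = 0) ∧
      (∀ i j, M i j = M j i) ∧ ∀ i, ∑ j, M i j = w i := by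
  classical
  have hne : (Finset.univ : Finset (Fin d)).Nonempty := by
    rw [Finset.univ_nonempty_iff]
    by_contra h
    rw [not_nonempty_iff] at h
    simp at hw1
  obtain ⟨i₀, -, hmax⟩ := Finset.exists_max_image Finset.univ w hne
  set R : ℝ := w i₀ with hR
  set T : ℝ := ∑ j ∈ Finset.univ.erase i₀, w j with hT
  have hRT : R + T = 1 := by
    rw [← Finset.add_sum_erase _ w (Finset.mem_univ i₀)] at hw1
    exact hw1
  have hTR : R ≤ T := by have := hw2 i₀; linarith
  have hwT : ∀ j, j ≠ i₀ → w j ≤ T := fun j hj =>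
    Finset.single_le_sum (f := w) (fun k _ => hw0 k) (Finset.mem_erase.2 ⟨hj, Finset.mem_univ j⟩)
  have hwR : ∀ j, w j ≤ R := fun j => hmax j (Finset.mem_univ j)
  set D : ℝ := ∑ j ∈ Finset.univ.erase i₀, w j * (T - w j) with hD
  have hD0 : 0 ≤ D := Finset.sum_nonneg fun j hj =>
    mul_nonneg (hw0 j) (sub_nonneg.2 (hwT j (Finset.ne_of_mem_erase hj)))
  have hTD : T * (T - R) ≤ D := by
    rw [hD, hT, Finset.sum_mul]
    exact Finset.sum_le_sum fun k _ => mul_le_mul_of_nonneg_left (by linarith [hwR k]) (hw0 k)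
  set c : ℝ := (T - R) / D with hc
  have hc0 : 0 ≤ c := div_nonneg (sub_nonneg.2 hTR) hD0
  -- the key bound `c (T - wⱼ) ≤ 1`
  have hcT : ∀ j, c * (T - w j) ≤ 1 := by
    intro j
    rcases hD0.eq_or_lt with hD00 | hDpos
    · rw [hc, ← hD00, div_zero, zero_mul]; exact zero_le_one
    · rw [hc, div_mul_eq_mul_div, div_le_one hDpos]
      nlinarith [mul_nonneg (hw0 j) (sub_nonneg.2 hTR)]
  -- in the degenerate case `D = 0` the maximum is half the mass
  have hdeg : D = 0 → T = R := by
    intro hD00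
    refine le_antisymm ?_ hTR
    rcases le_or_gt T R with hle | hlt
    · exact hle
    exfalso
    have hz : ∀ j ∈ Finset.univ.erase i₀, w j * (T - w j) = 0 :=
      (Finset.sum_eq_zero_iff_of_nonneg fun j hj =>
        mul_nonneg (hw0 j) (sub_nonneg.2 (hwT j (Finset.ne_of_mem_erase hj)))).1 (hD ▸ hD00)
    have hzero : ∀ j ∈ Finset.univ.erase i₀, w j = 0 := by
      intro j hj
      rcases mul_eq_zero.1 (hz j hj) with h | h
      · exact h
      · exfalso
        have : w j = T := by linarith
        linarith [hwR j]
    have hT0 : T = 0 := by rw [hT]; exact Finset.sum_eq_zero hzero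
    linarith [hw0 i₀]
  refine ⟨fun i j => if i = j then 0 else if i = i₀ then w j * (1 - c * (T - w j))
      else if j = i₀ then w i * (1 - c * (T - w i)) else c * (w i * w j),
    fun i j => ?_, fun i => ?_, fun i j => ?_, fun i => ?_⟩
  · -- nonnegativity
    dsimp only
    split_ifs
    · exact le_rfl
    · exact mul_nonneg (hw0 j) (by linarith [hcT j])
    · exact mul_nonneg (hw0 i) (by linarith [hcT i])
    · exact mul_nonneg hc0 (mul_nonneg (hw0 i) (hw0 j))
  · -- zero diagonal
    dsimp only
    rw [if_pos rfl]
  · -- symmetry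
    dsimp only
    rcases eq_or_ne i j with rfl | hij
    · rfl
    · have hji : j ≠ i := fun h => hij h.symm
      by_cases hi : i = i₀
      · have hj' : j ≠ i₀ := fun h => hij (hi.trans h.symm)
        rw [if_neg hij, if_pos hi, if_neg hji, if_neg hj', if_pos hi]
      · by_cases hj : j = i₀
        · rw [if_neg hij, if_neg hi, if_pos hj, if_neg hji, if_pos hj]
        · rw [if_neg hij, if_neg hi, if_neg hj, if_neg hji, if_neg hj, if_neg hi]
          ring
  · -- row sums
    dsimp only
    by_cases hi : i = i₀
    · subst hi
      rw [← Finset.add_sum_erase _ _ (Finset.mem_univ i), if_pos rfl, zero_add]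
      have hsum : ∑ x ∈ Finset.univ.erase i,
          (if i = x then 0 else if i = i then w x * (1 - c * (T - w x))
            else if x = i then w i * (1 - c * (T - w i)) else c * (w i * w x)) =
          ∑ x ∈ Finset.univ.erase i, (w x - c * (w x * (T - w x))) := by
        refine Finset.sum_congr rfl fun x hx => ?_
        rw [if_neg (Finset.ne_of_mem_erase hx).symm, if_pos rfl]
        ring
      rw [hsum, Finset.sum_sub_distrib, ← Finset.mul_sum, ← hT, ← hD]
      -- `T - c D = R`
      rcases hD0.eq_or_lt with hD00 | hDpos
      · rw [← hD00, mul_zero, sub_zero]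
        exact hdeg hD00.symm
      · rw [hc, div_mul_cancel₀ _ hDpos.ne']
        ring
    · have hi0 : i₀ ∈ Finset.univ.erase i := Finset.mem_erase.2 ⟨fun h => hi h.symm, Finset.mem_univ _⟩
      rw [← Finset.add_sum_erase _ _ (Finset.mem_univ i), if_pos rfl, zero_add,
        ← Finset.add_sum_erase _ _ hi0, if_neg hi, if_neg hi, if_pos rfl]
      have hsum : ∑ x ∈ (Finset.univ.erase i).erase i₀,
          (if i = x then 0 else if i = i₀ then w x * (1 - c * (T - w x))
            else if x = i₀ then w i * (1 - c * (T - w i)) else c * (w i * w x)) =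
          ∑ x ∈ (Finset.univ.erase i).erase i₀, c * w i * w x := by
        refine Finset.sum_congr rfl fun x hx => ?_
        have hx0 : x ≠ i₀ := Finset.ne_of_mem_erase hx
        have hxi : x ≠ i := Finset.ne_of_mem_erase (Finset.mem_of_mem_erase hx)
        rw [if_neg hxi.symm, if_neg hi, if_neg hx0]
        ring
      have hrest : ∑ x ∈ (Finset.univ.erase i).erase i₀, w x = T - w i := by
        have h := Finset.add_sum_erase (Finset.univ.erase i₀) w
          (Finset.mem_erase.2 ⟨hi, Finset.mem_univ i⟩)
        rw [Finset.erase_right_comm, ← hT] at h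
        linarith
      rw [hsum, ← Finset.mul_sum, hrest]
      ring

end PairWeights

/-! ### Jensen over the pairs: `F_K ≤ Σ_{i,j} M_{ij} F_{(1,1)}(pᵢ, pⱼ)` -/

section Jensen

variable {d : ℕ}

/-- The pair integrand at the point `(a, b)` is symmetric in `a, b`. [cite: KLS1988PRL, eq. (8)] -/
private theorem anisoKlsIntegrand_two_symm (a b : ℝ) :
    anisoKlsIntegrand ![(1 : ℝ), 1] ![a, b] = anisoKlsIntegrand ![(1 : ℝ), 1] ![b, a] := by
  rw [anisoKlsIntegrand_two_eq_klsH, anisoKlsIntegrand_two_eq_klsH, add_comm]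

/-- **Jensen over the pairs** (Kennedy–Lieb–Shastry's convexity step for arbitrary admissible
weights): for `K ≥ 0` with `κ_K > 0` and `2Kᵢ ≤ κ_K`, there are pair weights `M ≥ 0`, `M_{ii} = 0`,
`Σ_{i,j} M_{ij} = 1`, with `F_K(p) ≤ Σᵢ Σⱼ M_{ij} F_{(1,1)}(pᵢ, pⱼ)` whenever all `cos pᵢ < 1`
(`C_K(p)/κ_K = Σ_{i,j} M_{ij} ½(cos pᵢ + cos pⱼ)` and `H` is convex below `1`).
[cite: KLS1988PRL, after eq. (8)] -/
theorem anisoKlsIntegrand_le_sum_pairs {K : Fin d → ℝ} (hK : ∀ i, 0 ≤ K i) (hκ : 0 < ∑ i, K i)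
    (h2 : ∀ i, 2 * K i ≤ ∑ j, K j) :
    ∃ M : Fin d → Fin d → ℝ, (∀ i j, 0 ≤ M i j) ∧ (∀ i, M i i = 0) ∧ (∑ i, ∑ j, M i j = 1) ∧
      ∀ p : Fin d → ℝ, (∀ i, Real.cos (p i) < 1) →
        anisoKlsIntegrand K p ≤
          ∑ i, ∑ j, M i j * anisoKlsIntegrand ![(1 : ℝ), 1] ![p i, p j] := by
  set κ : ℝ := ∑ i, K i with hκ_def
  set w : Fin d → ℝ := fun i => K i / κ with hw
  have hw0 : ∀ i, 0 ≤ w i := fun i => div_nonneg (hK i) hκ.le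
  have hw1 : ∑ i, w i = 1 := by
    rw [hw]
    simp only
    rw [← Finset.sum_div, div_self hκ.ne']
  have hw2 : ∀ i, 2 * w i ≤ 1 := fun i => by
    rw [hw]
    simp only
    rw [mul_div_assoc', div_le_one hκ]
    exact h2 i
  obtain ⟨M, hM0, hMd, hMs, hMr⟩ := exists_symm_pairWeights w hw0 hw1 hw2
  have hM1 : ∑ i, ∑ j, M i j = 1 := by
    rw [← hw1]
    exact Finset.sum_congr rfl fun i _ => hMr i
  refine ⟨M, hM0, hMd, hM1, fun p hp => ?_⟩
  -- Jensen over `univ : Finset (Fin d × Fin d)` with weights `M` and points `½(cos pᵢ + cos pⱼ)`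
  have hmem : ∀ ij ∈ (Finset.univ : Finset (Fin d × Fin d)),
      (fun ij : Fin d × Fin d => (Real.cos (p ij.1) + Real.cos (p ij.2)) / 2) ij ∈ Iio (1 : ℝ) := by
    intro ij _
    show (Real.cos (p ij.1) + Real.cos (p ij.2)) / 2 < 1
    linarith [hp ij.1, hp ij.2]
  have hw0' : ∀ ij ∈ (Finset.univ : Finset (Fin d × Fin d)),
      0 ≤ (fun ij : Fin d × Fin d => M ij.1 ij.2) ij := fun ij _ => hM0 ij.1 ij.2
  have hw1' : ∑ ij, (fun ij : Fin d × Fin d => M ij.1 ij.2) ij = 1 := by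
    rw [Fintype.sum_prod_type]
    exact hM1
  have hJ := convexOn_klsH.map_sum_le hw0' hw1' hmem
  -- the barycentre is `C_K(p)/κ_K`
  have hrow : ∀ i, ∑ j, M i j * Real.cos (p i) = w i * Real.cos (p i) := fun i => by
    rw [← Finset.sum_mul, hMr i]
  have hcol : ∀ j, ∑ i, M i j * Real.cos (p j) = w j * Real.cos (p j) := fun j => by
    rw [← Finset.sum_mul]
    congr 1
    rw [← hMr j]
    exact Finset.sum_congr rfl fun i _ => hMs i j
  have hbary : ∑ ij, (fun ij : Fin d × Fin d => M ij.1 ij.2) ij •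
      (fun ij : Fin d × Fin d => (Real.cos (p ij.1) + Real.cos (p ij.2)) / 2) ij =
        anisoCosSum K p / κ := by
    simp only [smul_eq_mul]
    rw [Fintype.sum_prod_type]
    have hsplit : ∀ i j : Fin d, M i j * ((Real.cos (p i) + Real.cos (p j)) / 2) =
        (M i j * Real.cos (p i)) / 2 + (M i j * Real.cos (p j)) / 2 := fun i j => by ring
    simp only [hsplit, Finset.sum_add_distrib, ← Finset.sum_div]
    rw [Finset.sum_congr rfl fun i _ => hrow i, Finset.sum_comm,
      Finset.sum_congr rfl fun j _ => hcol j, anisoCosSum, hw]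
    simp only
    rw [add_halves]
    simp_rw [div_mul_eq_mul_div]
    rw [← Finset.sum_div]
  rw [hbary] at hJ
  rw [anisoKlsIntegrand_eq_klsH hκ]
  refine hJ.trans (le_of_eq ?_)
  rw [Fintype.sum_prod_type]
  refine Finset.sum_congr rfl fun i _ => Finset.sum_congr rfl fun j _ => ?_
  rw [smul_eq_mul, anisoKlsIntegrand_two_eq_klsH]

end Jensen

/-! ### Integrating out the other coordinates: `∫_{[-π,π]^{n+2}} f(pᵢ,pⱼ) = (2π)ⁿ ∫_{[-π,π]²} f` -/

section PairMarginal

/-- On `n + 3 ≥ 3` indices there is an index different from two given ones. [folklore] -/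
private theorem exists_ne_ne {n : ℕ} (i j : Fin (n + 1 + 2)) : ∃ k : Fin (n + 1 + 2), k ≠ i ∧ k ≠ j := by
  classical
  by_contra h
  have hsub : (Finset.univ : Finset (Fin (n + 1 + 2))) ⊆ {i, j} := by
    intro k _
    rw [Finset.mem_insert, Finset.mem_singleton]
    by_contra hk
    exact h ⟨k, fun h1 => hk (Or.inl h1), fun h2 => hk (Or.inr h2)⟩
  have hcard := Finset.card_le_card hsub
  rw [Finset.card_univ, Fintype.card_fin] at hcard
  have h2 : ({i, j} : Finset (Fin (n + 1 + 2))).card ≤ 2 :=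
    (Finset.card_insert_le _ _).trans (by rw [Finset.card_singleton])
  omega

/-- **Integrating out all but two coordinates**: for `i ≠ j` in `Fin (n+2)` and a symmetric
measurable `f ≥ 0` on `ℝ²`, `∫_{[-π,π]^{n+2}} f(pᵢ, pⱼ) dp = (2π)ⁿ ∫_{[-π,π]²} f(q₀, q₁) dq` (the
tree's one-coordinate deletion `setLIntegral_box_comp_succAbove`, iterated at coordinates other
than `i, j`). This is the step "`(2π)^{-ν}∫F({Y_{ij}(p)}₊)dᵛp = I(2)`" of Kennedy–Lieb–Shastry.
[cite: KLS1988PRL, after eq. (8)] -/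
theorem setLIntegral_box_pair {n : ℕ} {i j : Fin (n + 2)} (hij : i ≠ j) {f : ℝ → ℝ → ℝ≥0∞}
    (hf : Measurable (Function.uncurry f)) (hsymm : ∀ a b, f a b = f b a) :
    ∫⁻ p in Set.pi univ (fun _ : Fin (n + 2) => Icc (-Real.pi) Real.pi), f (p i) (p j) =
      ENNReal.ofReal (2 * Real.pi) ^ n *
        ∫⁻ q in Set.pi univ (fun _ : Fin 2 => Icc (-Real.pi) Real.pi), f (q 0) (q 1) := by
  induction n with
  | zero =>
      rw [pow_zero, one_mul]
      obtain ⟨hi, hj⟩ | ⟨hi, hj⟩ : (i = 0 ∧ j = 1) ∨ (i = 1 ∧ j = 0) := by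
        fin_cases i <;> fin_cases j <;> simp_all
      · subst hi; subst hj; rfl
      · subst hi; subst hj
        exact lintegral_congr fun p => hsymm _ _
  | succ n ih =>
      obtain ⟨k, hki, hkj⟩ := exists_ne_ne i j
      obtain ⟨i', rfl⟩ := Fin.exists_succAbove_eq hki.symm
      obtain ⟨j', rfl⟩ := Fin.exists_succAbove_eq hkj.symm
      have hij' : i' ≠ j' := fun h => hij (by rw [h])
      have hF : Measurable fun q : Fin (n + 2) → ℝ => f (q i') (q j') :=
        hf.comp (f := fun q : Fin (n + 2) → ℝ => (q i', q j'))
          ((measurable_pi_apply i').prodMk (measurable_pi_apply j'))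
      calc ∫⁻ p in Set.pi univ (fun _ : Fin (n + 1 + 2) => Icc (-Real.pi) Real.pi),
            f (p (k.succAbove i')) (p (k.succAbove j'))
          = ENNReal.ofReal (2 * Real.pi) *
              ∫⁻ q in Set.pi univ (fun _ : Fin (n + 2) => Icc (-Real.pi) Real.pi), f (q i') (q j') :=
            setLIntegral_box_comp_succAbove k (f := fun q : Fin (n + 2) → ℝ => f (q i') (q j')) hF
        _ = ENNReal.ofReal (2 * Real.pi) * (ENNReal.ofReal (2 * Real.pi) ^ n *
              ∫⁻ q in Set.pi univ (fun _ : Fin 2 => Icc (-Real.pi) Real.pi), f (q 0) (q 1)) := by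
            rw [ih hij']
        _ = ENNReal.ofReal (2 * Real.pi) ^ (n + 1) *
              ∫⁻ q in Set.pi univ (fun _ : Fin 2 => Icc (-Real.pi) Real.pi), f (q 0) (q 1) := by
            rw [pow_succ]
            ring

end PairMarginal

/-! ### The reduction `I_K ≤ I_{(1,1)}` in every dimension -/

section Reduction

/-- `F_K` is measurable (local copy of the private lemma of `AnisotropicKLSIntegralBound.lean`).
[cite: KLS1988PRL, eq. (8)] -/
private theorem anisoKlsIntegrand_measurable'' {d : ℕ} (K : Fin d → ℝ) :
    Measurable (anisoKlsIntegrand K) := by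
  unfold anisoKlsIntegrand anisoCosSum NVectorAniso.anisoDispersion
  refine Measurable.mul ?_ (Real.continuous_sqrt.measurable.comp ?_)
  · exact (Finset.measurable_sum _ fun i _ =>
      (Real.measurable_cos.comp (measurable_pi_apply i)).const_mul _).max measurable_const
  · exact measurable_const.div (measurable_const.mul (Finset.measurable_sum _ fun i _ =>
      (measurable_const.sub (Real.measurable_cos.comp (measurable_pi_apply i))).const_mul _))

/-- The map `(a, b) ↦ (a, b)` from `ℝ × ℝ` to `Fin 2 → ℝ` (as `![a, b]`) is measurable. [folklore] -/
private theorem measurable_vecCons_two : Measurable fun ab : ℝ × ℝ => (![ab.1, ab.2] : Fin 2 → ℝ) := by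
  refine measurable_pi_iff.2 fun k => ?_
  fin_cases k
  · simpa using measurable_fst
  · simpa using measurable_snd

/-- The pair integrand `(a, b) ↦ F_{(1,1)}(a, b)` is jointly measurable. [cite: KLS1988PRL, eq. (8)] -/
private theorem measurable_pairIntegrand :
    Measurable (Function.uncurry fun a b : ℝ =>
      ENNReal.ofReal (anisoKlsIntegrand ![(1 : ℝ), 1] ![a, b])) :=
  (ENNReal.measurable_ofReal.comp (anisoKlsIntegrand_measurable'' _)).comp measurable_vecCons_two

/-- Termwise integration of a pair sum: with `M_{ii} = 0`,
`∫ Σᵢⱼ M_{ij} f(pᵢ,pⱼ) = (Σᵢⱼ M_{ij}) (2π)ⁿ ∫_{[-π,π]²} f`. [cite: KLS1988PRL, after eq. (8)] -/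
private theorem lintegral_box_sum_pairs {n : ℕ} (M : Fin (n + 2) → Fin (n + 2) → ℝ)
    (hMd : ∀ i, M i i = 0) {f : ℝ → ℝ → ℝ≥0∞} (hf : Measurable (Function.uncurry f))
    (hsymm : ∀ a b, f a b = f b a) :
    ∫⁻ p in Set.pi univ (fun _ : Fin (n + 2) => Icc (-Real.pi) Real.pi),
        ∑ i, ∑ j, ENNReal.ofReal (M i j) * f (p i) (p j) =
      (∑ i, ∑ j, ENNReal.ofReal (M i j)) * (ENNReal.ofReal (2 * Real.pi) ^ n *
        ∫⁻ q in Set.pi univ (fun _ : Fin 2 => Icc (-Real.pi) Real.pi), f (q 0) (q 1)) := by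
  have hmeas : ∀ i j : Fin (n + 2), Measurable fun p : Fin (n + 2) → ℝ => f (p i) (p j) :=
    fun i j => hf.comp (f := fun p : Fin (n + 2) → ℝ => (p i, p j))
      ((measurable_pi_apply i).prodMk (measurable_pi_apply j))
  rw [lintegral_finsetSum _ fun i _ => Finset.measurable_sum _ fun j _ => (hmeas i j).const_mul _,
    Finset.sum_mul]
  refine Finset.sum_congr rfl fun i _ => ?_
  rw [lintegral_finsetSum _ fun j _ => (hmeas i j).const_mul _, Finset.sum_mul]
  refine Finset.sum_congr rfl fun j _ => ?_
  rw [lintegral_const_mul _ (hmeas i j)]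
  rcases eq_or_ne i j with rfl | hij
  · rw [hMd i, ENNReal.ofReal_zero, zero_mul, zero_mul]
  · rw [setLIntegral_box_pair hij hf hsymm]

/-- **The convexity reduction in every dimension, as an inequality of Lebesgue integrals**:
`∫_{[-π,π]^{n+2}} F_K ≤ (2π)ⁿ ∫_{[-π,π]²} F_{(1,1)}` for `K ≥ 0` on `n + 2` directions with
`κ_K > 0` and `2 max K ≤ κ_K` (Jensen over the pairs a.e., then `setLIntegral_box_pair` termwise;
the pair weights sum to `1`). [cite: KLS1988PRL, after eq. (8)] -/
theorem lintegral_anisoKlsIntegrand_le_two_pow {n : ℕ} {K : Fin (n + 2) → ℝ} (hK : ∀ i, 0 ≤ K i)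
    (hκ : 0 < ∑ i, K i) (h2 : ∀ i, 2 * K i ≤ ∑ j, K j) :
    ∫⁻ p in Set.pi univ (fun _ : Fin (n + 2) => Icc (-Real.pi) Real.pi),
        ENNReal.ofReal (anisoKlsIntegrand K p) ≤
      ENNReal.ofReal (2 * Real.pi) ^ n *
        ∫⁻ q in Set.pi univ (fun _ : Fin 2 => Icc (-Real.pi) Real.pi),
          ENNReal.ofReal (anisoKlsIntegrand ![(1 : ℝ), 1] q) := by
  obtain ⟨M, hM0, hMd, hM1, hle⟩ := anisoKlsIntegrand_le_sum_pairs hK hκ h2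
  have hfs : ∀ a b : ℝ, ENNReal.ofReal (anisoKlsIntegrand ![(1 : ℝ), 1] ![a, b]) =
      ENNReal.ofReal (anisoKlsIntegrand ![(1 : ℝ), 1] ![b, a]) :=
    fun a b => congrArg ENNReal.ofReal (anisoKlsIntegrand_two_symm a b)
  have hae := ae_restrict_of_ae (s := Set.pi univ (fun _ : Fin (n + 2) => Icc (-Real.pi) Real.pi))
    (ae_forall_cos_apply_lt_one (n + 2))
  have hsumM : ∑ i, ∑ j, ENNReal.ofReal (M i j) = 1 := by
    rw [← ENNReal.ofReal_one, ← hM1,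
      ENNReal.ofReal_sum_of_nonneg (fun i _ => Finset.sum_nonneg fun j _ => hM0 i j)]
    exact Finset.sum_congr rfl fun i _ => (ENNReal.ofReal_sum_of_nonneg fun j _ => hM0 i j).symm
  -- the two-dimensional integral, in the form `f (q 0) (q 1)`
  have h2d : ∫⁻ q in Set.pi univ (fun _ : Fin 2 => Icc (-Real.pi) Real.pi),
      ENNReal.ofReal (anisoKlsIntegrand ![(1 : ℝ), 1] ![q 0, q 1]) =
      ∫⁻ q in Set.pi univ (fun _ : Fin 2 => Icc (-Real.pi) Real.pi),
        ENNReal.ofReal (anisoKlsIntegrand ![(1 : ℝ), 1] q) := by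
    refine lintegral_congr fun q => ?_
    congr 2
    ext k
    fin_cases k <;> rfl
  calc ∫⁻ p in Set.pi univ (fun _ : Fin (n + 2) => Icc (-Real.pi) Real.pi),
        ENNReal.ofReal (anisoKlsIntegrand K p)
      ≤ ∫⁻ p in Set.pi univ (fun _ : Fin (n + 2) => Icc (-Real.pi) Real.pi),
          ENNReal.ofReal (∑ i, ∑ j, M i j * anisoKlsIntegrand ![(1 : ℝ), 1] ![p i, p j]) :=
        lintegral_mono_ae (hae.mono fun p hp => ENNReal.ofReal_le_ofReal (hle p hp))
    _ = ∫⁻ p in Set.pi univ (fun _ : Fin (n + 2) => Icc (-Real.pi) Real.pi),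
          ∑ i, ∑ j, ENNReal.ofReal (M i j) *
            ENNReal.ofReal (anisoKlsIntegrand ![(1 : ℝ), 1] ![p i, p j]) := by
        refine lintegral_congr fun p => ?_
        rw [ENNReal.ofReal_sum_of_nonneg fun i _ => Finset.sum_nonneg fun j _ =>
          mul_nonneg (hM0 i j) (anisoKlsIntegrand_nonneg _ _)]
        refine Finset.sum_congr rfl fun i _ => ?_
        rw [ENNReal.ofReal_sum_of_nonneg fun j _ => mul_nonneg (hM0 i j) (anisoKlsIntegrand_nonneg _ _)]
        exact Finset.sum_congr rfl fun j _ => ENNReal.ofReal_mul (hM0 i j)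
    _ = (∑ i, ∑ j, ENNReal.ofReal (M i j)) * (ENNReal.ofReal (2 * Real.pi) ^ n *
          ∫⁻ q in Set.pi univ (fun _ : Fin 2 => Icc (-Real.pi) Real.pi),
            ENNReal.ofReal (anisoKlsIntegrand ![(1 : ℝ), 1] ![q 0, q 1])) :=
        lintegral_box_sum_pairs M hMd
          (f := fun a b : ℝ => ENNReal.ofReal (anisoKlsIntegrand ![(1 : ℝ), 1] ![a, b]))
          measurable_pairIntegrand hfs
    _ = ENNReal.ofReal (2 * Real.pi) ^ n *
          ∫⁻ q in Set.pi univ (fun _ : Fin 2 => Icc (-Real.pi) Real.pi),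
            ENNReal.ofReal (anisoKlsIntegrand ![(1 : ℝ), 1] q) := by
        rw [hsumM, one_mul, h2d]

/-- **`I_K ≤ I_{(1,1)}` in every dimension**: for `K ≥ 0` on `n + 2` directions with `κ_K > 0` and
`2 max K ≤ κ_K` — Kennedy–Lieb–Shastry's `I(ν) ≤ I(2)` for direction-dependent couplings.
[cite: KLS1988PRL, after eq. (8)] -/
theorem anisoKlsIntegral_le_two {n : ℕ} {K : Fin (n + 2) → ℝ} (hK : ∀ i, 0 ≤ K i)
    (hκ : 0 < ∑ i, K i) (h2 : ∀ i, 2 * K i ≤ ∑ j, K j) :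
    anisoKlsIntegral K ≤ anisoKlsIntegral ![(1 : ℝ), 1] := by
  rw [anisoKlsIntegral_eq_toReal_lintegral, anisoKlsIntegral_eq_toReal_lintegral]
  have hfin : ∫⁻ q in Set.pi univ (fun _ : Fin 2 => Icc (-Real.pi) Real.pi),
      ENNReal.ofReal (anisoKlsIntegrand ![(1 : ℝ), 1] q) < ∞ :=
    lintegral_anisoKlsIntegrand_two_le.trans_lt ENNReal.ofReal_lt_top
  have hstep := lintegral_anisoKlsIntegrand_le_two_pow hK hκ h2
  have h2π : (0 : ℝ) ≤ 2 * Real.pi := by positivity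
  have hmono := ENNReal.toReal_mono
    (ENNReal.mul_ne_top (ENNReal.pow_ne_top ENNReal.ofReal_ne_top) hfin.ne) hstep
  rw [ENNReal.toReal_mul, ENNReal.toReal_pow, ENNReal.toReal_ofReal h2π] at hmono
  refine (div_le_div_of_nonneg_right hmono (by positivity)).trans (le_of_eq ?_)
  rw [pow_add]
  have hπ : (2 * Real.pi) ^ n ≠ 0 := by positivity
  field_simp
  ring

/-- **`I_K < 1/√2` in every dimension `d ≥ 2`** for `K ≥ 0` with `κ_K > 0` and `2 max K ≤ κ_K`
(`I_K ≤ I_{(1,1)} < √2/2`, `anisoKlsIntegral_two_lt`). [cite: KLS1988PRL, after eq. (8)] -/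
theorem anisoKlsIntegral_lt_of_two_mul_le {d : ℕ} (hd : 2 ≤ d) {K : Fin d → ℝ} (hK : ∀ i, 0 ≤ K i)
    (hκ : 0 < ∑ i, K i) (h2 : ∀ i, 2 * K i ≤ ∑ j, K j) :
    anisoKlsIntegral K < Real.sqrt 2 / 2 := by
  obtain ⟨n, rfl⟩ : ∃ n, d = n + 2 := ⟨d - 2, by omega⟩
  exact (anisoKlsIntegral_le_two hK hκ h2).trans_lt anisoKlsIntegral_two_lt

/-- The isotropic couplings `K ≡ 1` are admissible for `d ≥ 2`: `I_{(1,…,1)} < 1/√2`.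
[cite: KLS1988PRL, after eq. (8) (`I(ν) ≤ I(2)`)] -/
theorem anisoKlsIntegral_const_one_lt {d : ℕ} (hd : 2 ≤ d) :
    anisoKlsIntegral (fun _ : Fin d => (1 : ℝ)) < Real.sqrt 2 / 2 := by
  have hs : ∑ _i : Fin d, (1 : ℝ) = d := by simp
  refine anisoKlsIntegral_lt_of_two_mul_le hd (fun _ => zero_le_one) (by rw [hs]; positivity)
    fun _ => ?_
  rw [hs]
  exact_mod_cast (by omega : 2 * 1 ≤ d)

end Reduction

/-! ### Long-range order in every dimension `d ≥ 3` -/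

section Order

variable {d : ℕ}

/-- **Ground-state long-range order for direction-dependent couplings in every dimension `d ≥ 3`,
unconditional**: for every `K > 0` with `2 max K ≤ Σᵢ Kᵢ` and every spin `S = n/2 ≥ ½`, the
ground states of `H_K = -Σ_xΣᵢ Kᵢ(S¹_xS¹_{x+eᵢ} + S²_xS²_{x+eᵢ})` on the even tori `(ℤ/2kℤ)^d` have
long-range order (Kennedy–Lieb–Shastry's theorem for direction-dependent couplings, XY /
hard-core-boson version; the lattice-integral hypothesis discharged by
`anisoKlsIntegral_lt_of_two_mul_le`). [cite: KLS1988PRL, Theorem, eq. (8)] [cite: KLS1988JSP, §3] -/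
theorem xyAniso_longRangeOrder_ground_of_two_mul_le (hd3 : 3 ≤ d) {K : Fin d → ℝ}
    (hK : ∀ i, 0 < K i) (h2 : ∀ i, 2 * K i ≤ ∑ j, K j) {n : ℕ} (hn : 1 ≤ n) :
    HasEvenTorusLRO
      (fun L x y => xyAnisoGroundCorr 0 L n K x y + xyAnisoGroundCorr 1 L n K x y) := by
  haveI : Nonempty (Fin d) := ⟨⟨0, by omega⟩⟩
  have hκ : 0 < ∑ i, K i := Finset.sum_pos (fun i _ => hK i) Finset.univ_nonempty
  refine xyAniso_longRangeOrder_ground_of_integral hd3 hK hn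
    ((anisoKlsIntegral_lt_of_two_mul_le (by omega) (fun i => (hK i).le) hκ h2).trans_le ?_)
  have hn1 : (1 : ℝ) ≤ n := by exact_mod_cast hn
  have := Real.sqrt_nonneg 2
  nlinarith

/-- **Long-range order at low temperature for direction-dependent couplings in every dimension
`d ≥ 3`, unconditional**: for every `K > 0` with `2 max K ≤ Σᵢ Kᵢ` and every spin `S = n/2 ≥ ½`
there is `β₀ > 0` such that for all `β ≥ β₀` the Gibbs states of `H_K` on the even tori `(ℤ/2kℤ)^d`
have long-range order. [cite: DysonLiebSimon1978, Thms. 5.1, 5.2] [cite: KLS1988JSP, p. 1020]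
[cite: KLS1988PRL, Theorem, eq. (8)] -/
theorem xyAniso_longRangeOrder_thermal_of_two_mul_le (hd3 : 3 ≤ d) {K : Fin d → ℝ}
    (hK : ∀ i, 0 < K i) (h2 : ∀ i, 2 * K i ≤ ∑ j, K j) {n : ℕ} (hn : 1 ≤ n) :
    ∃ β₀ : ℝ, 0 < β₀ ∧ ∀ β : ℝ, β₀ ≤ β →
      HasEvenTorusLRO (fun L x y => xyAnisoThermalCorr β K L n x y) := by
  haveI : Nonempty (Fin d) := ⟨⟨0, by omega⟩⟩
  have hκ : 0 < ∑ i, K i := Finset.sum_pos (fun i _ => hK i) Finset.univ_nonempty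
  refine xyAniso_longRangeOrder_thermal_of_integral hd3 hK hn
    ((anisoKlsIntegral_lt_of_two_mul_le (by omega) (fun i => (hK i).le) hκ h2).trans_le ?_)
  have hn1 : (1 : ℝ) ≤ n := by exact_mod_cast hn
  have := Real.sqrt_nonneg 2
  nlinarith

/-- **An explicit floor on the ground-state order parameter in every dimension `d ≥ 3`**: for every
`K > 0` with `2 max K ≤ Σᵢ Kᵢ` and every spin `S = n/2 ≥ ½`, along the even tori
`liminf_k |Λ_k|⁻² Σ_{x,y∈Λ_k}⟨S¹_xS¹_y + S²_xS²_y⟩_GS ≥ n²/4 - n(1/8 + 3823/(10080π))`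
(`= 0.0042…` for `S = ½`, `0.508…` for `S = 1`; Kennedy–Lieb–Shastry's eq. (7) in the limit with
`I_K ≤ I_{(1,1)} ≤ √2/4 + (3823/5040)√2/π`). [cite: KLS1988PRL, Theorem, eqs. (7)–(8)]
[cite: KLS1988JSP, §3] -/
theorem xyAniso_groundOrderParameter_ge_of_two_mul_le (hd3 : 3 ≤ d) {K : Fin d → ℝ}
    (hK : ∀ i, 0 < K i) (h2 : ∀ i, 2 * K i ≤ ∑ j, K j) {n : ℕ} (hn : 1 ≤ n) :
    (n : ℝ) ^ 2 / 4 - n * (1 / 8 + 3823 / (10080 * Real.pi)) ≤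
      liminf (fun k : ℕ => (∑ x ∈ halfOpenBox d (2 * k), ∑ y ∈ halfOpenBox d (2 * k),
        torusPullback (fun L x y => xyAnisoGroundCorr 0 L n K x y + xyAnisoGroundCorr 1 L n K x y)
          (2 * k) x y) / ((halfOpenBox d (2 * k)).card : ℝ) ^ 2) atTop := by
  haveI : Nonempty (Fin d) := ⟨⟨0, by omega⟩⟩
  obtain ⟨m, rfl⟩ : ∃ m, d = m + 2 := ⟨d - 2, by omega⟩
  have hκ : 0 < ∑ i, K i := Finset.sum_pos (fun i _ => hK i) Finset.univ_nonempty
  have hn1 : (1 : ℝ) ≤ n := by exact_mod_cast hn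
  have hs2 := Real.sqrt_nonneg 2
  have hle2 := anisoKlsIntegral_le_two (fun i => (hK i).le) hκ h2
  have hIlt : anisoKlsIntegral K < n * Real.sqrt 2 / 2 :=
    (hle2.trans_lt anisoKlsIntegral_two_lt).trans_le (by nlinarith)
  have hfloor := xyAniso_groundOrderParameter_ge hd3 hK hn hIlt
  have hsq : Real.sqrt (((n : ℝ) / 2) ^ 2 / 2) = n * Real.sqrt 2 / 4 := by
    have h2 : ((n : ℝ) / 2) ^ 2 / 2 = (n * Real.sqrt 2 / 4) ^ 2 := by
      rw [div_pow, div_pow, mul_pow, Real.sq_sqrt (by norm_num : (0 : ℝ) ≤ 2)]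
      ring
    rw [h2, Real.sqrt_sq (by positivity)]
  rw [hsq] at hfloor
  have hIb : anisoKlsIntegral K ≤ Real.sqrt 2 / 4 + 3823 / 5040 * Real.sqrt 2 / Real.pi :=
    hle2.trans anisoKlsIntegral_two_le
  have h22 : Real.sqrt 2 ^ 2 = 2 := Real.sq_sqrt (by norm_num)
  have hid : (n : ℝ) ^ 2 / 4 - n * (1 / 8 + 3823 / (10080 * Real.pi)) =
      2 * (((n : ℝ) / 2) ^ 2 / 2 - 1 / 2 * (n * Real.sqrt 2 / 4) *
        (Real.sqrt 2 / 4 + 3823 / 5040 * Real.sqrt 2 / Real.pi)) := by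
    linear_combination ((n : ℝ) / 16 + 3823 * n / (20160 * Real.pi)) * h22
  rw [hid]
  refine le_trans ?_ hfloor
  have hc0 : 0 ≤ (n : ℝ) * Real.sqrt 2 / 4 := by positivity
  nlinarith [mul_le_mul_of_nonneg_left hIb hc0]

end Order

end Literature.MathematicalPhysics.QuantumLattice
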